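import Mathlib
import Literature.RingTheory.RegularLocalRing.ParameterIdealSocle
import HarnessLib

set_option linter.dupNamespace false

/-!
# The type of a Cohen–Macaulay local ring is an invariant (cyclic-socle form)

Stub `stub_socle_cyclic_of_one` of the skeleton `Sketch` for crux stmt-ResolutionOfSingularities-15317
(`FrobeniusLadder.FRationalResolution`, "F-rational ⇒ weakly F-regular" on the Gorenstein sector).
Let `(R, 𝔪)` be a Noetherian local ring in which every *parameter list* — a list of `dim R`
elements of `𝔪` generating an `𝔪`-primary ideal — is a weakly regular sequence (hypothesis `hCM`;
e.g. `R` Cohen–Macaulay). If ONE parameter ideal `(Q₁)` has cyclic socle,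
`((Q₁) : 𝔪) = (Q₁) + (t₁)`, then EVERY parameter ideal `(Q₂)` has: `((Q₂) : 𝔪) = (Q₂) + (t₂)`.

Proof. This is the exchange chain of `Literature/RingTheory/RegularLocalRing/ParameterIdealSocle.lean`
(Matsumura 18.1 for regular local rings), with regularity replaced by `hCM`: two parameter lists are
joined by a chain in which one member is exchanged at a time (`socleOne_colon_cyclic_iff_of_append`);
by prime avoidance the new member `g` can be chosen outside the minimal primes of the retained
members of both lists (`socleOne_exists_exchange`, none of these primes being `𝔪` by Krull's height
theorem, `socleOne_maximalIdeal_notMem_minimalPrimes_ofList`), which keeps the ideals `𝔪`-primary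
(`Literature.RingTheory.RegularLocalRing.exists_pow_le_span_sup_of_forall_notMem`). By `hCM` the
reordered list "retained members, then the exchanged one" is weakly regular, so the exchanged
member is a non-zero-divisor modulo the retained ones (`socleOne_mem_of_mul_mem`,
`RingTheory.Sequence.isWeaklyRegular_append_iff`), and the socle is cyclic before the exchange iff
it is after it (`Literature.RingTheory.RegularLocalRing.exists_colon_eq_sup_span_swap`). Running the
chain from `Q₁` to `Q₂` and feeding `hsoc` gives the claim.

## References

* H. Matsumura, *Commutative Ring Theory*, CUP 1986, Thm. 14.1, Thm. 18.1. [Matsumura1987]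
* W. Bruns, J. Herzog, *Cohen–Macaulay rings*, CUP 1998, Lemma 1.2.4, 1.2.19. [BrunsHerzog1998]
-/

open IsLocalRing RingTheory.Sequence Literature.RingTheory.RegularLocalRing

namespace Summit.ResolutionOfSingularities.ResolutionOfSingularities.Theorems.FRationalResolution

-- adapted from Literature/RingTheory/RegularLocalRing/ParameterIdealSocle.lean (`mem_of_mul_mem_of_sop`)
/-- In a Noetherian local ring all of whose parameter lists are weakly regular, the last member of a
parameter list is a non-zero-divisor modulo the others. [cite: BrunsHerzog1998, Thm. 2.1.2] -/
theorem socleOne_mem_of_mul_mem {R : Type*} [CommRing R] [IsLocalRing R]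
    (hCM : ∀ Q : List R, (Q.length : WithBot ℕ∞) = ringKrullDim R →
      (∀ q ∈ Q, q ∈ maximalIdeal R) → (∃ N : ℕ, maximalIdeal R ^ N ≤ Ideal.ofList Q) →
      IsWeaklyRegular R Q)
    (B : List R) (a : R) (hlen : ((B ++ [a]).length : WithBot ℕ∞) = ringKrullDim R)
    (hm : ∀ q ∈ B ++ [a], q ∈ maximalIdeal R) {N : ℕ}
    (hN : maximalIdeal R ^ N ≤ Ideal.ofList (B ++ [a])) (x : R) (hx : a * x ∈ Ideal.ofList B) :
    x ∈ Ideal.ofList B := by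
  have hreg : IsWeaklyRegular R (B ++ [a]) := hCM (B ++ [a]) hlen hm ⟨N, hN⟩
  have hw := ((isWeaklyRegular_append_iff R B [a]).mp hreg).2
  rw [isWeaklyRegular_singleton_iff] at hw
  have hI : (Ideal.ofList B • ⊤ : Submodule R R) = Ideal.ofList B := by
    rw [Ideal.smul_eq_mul, Ideal.mul_top]
  have h0 : a • (Submodule.Quotient.mk x : R ⧸ (Ideal.ofList B • ⊤ : Submodule R R)) = a • 0 := by
    rw [smul_zero, ← Submodule.Quotient.mk_smul, Submodule.Quotient.mk_eq_zero, hI, smul_eq_mul]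
    exact hx
  have := hw h0
  rwa [Submodule.Quotient.mk_eq_zero, hI] at this

-- adapted from Literature/RingTheory/RegularLocalRing/ParameterIdealSocle.lean
-- (`maximalIdeal_notMem_minimalPrimes_ofList`, stated there under `IsRegularLocalRing`)
/-- In a Noetherian local ring of dimension `n`, the maximal ideal is not a minimal prime of an
ideal generated by fewer than `n` elements (Krull's height theorem).
[cite: Matsumura1987, Thm. 13.5] -/
theorem socleOne_maximalIdeal_notMem_minimalPrimes_ofList {R : Type*} [CommRing R]
    [IsNoetherianRing R] [IsLocalRing R] (B : List R)
    (hB : (B.length : WithBot ℕ∞) < ringKrullDim R) :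
    maximalIdeal R ∉ (Ideal.ofList B).minimalPrimes := by
  intro h
  have h1 := height_le_length_of_mem_minimalPrimes_ofList h
  have h2 := IsLocalRing.maximalIdeal_height_eq_ringKrullDim (R := R)
  rw [← h2] at hB
  exact absurd (WithBot.coe_le_coe.mpr h1) (not_le.mpr hB)

-- adapted from Literature/RingTheory/RegularLocalRing/ParameterIdealSocle.lean (`exists_exchange`)
/-- **Exchange step.** Given two `𝔪`-primary ideals `(a₁) + (B₁)`, `(a₂) + (B₂)` of a Noetherian
local ring with `B₁`, `B₂` lists of fewer than `dim R` elements, there is `g ∈ 𝔪` such that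
`(g) + (B₁)` and `(g) + (B₂)` are both `𝔪`-primary (prime avoidance over the minimal primes of
`(B₁)` and `(B₂)`, none of which is `𝔪`). [cite: Matsumura1987, Thm. 14.1] -/
theorem socleOne_exists_exchange {R : Type*} [CommRing R] [IsNoetherianRing R] [IsLocalRing R]
    (B₁ B₂ : List R) (hB₁ : (B₁.length : WithBot ℕ∞) < ringKrullDim R)
    (hB₂ : (B₂.length : WithBot ℕ∞) < ringKrullDim R) {a₁ a₂ : R}
    (ha₁ : a₁ ∈ maximalIdeal R) (ha₂ : a₂ ∈ maximalIdeal R) {N₁ N₂ : ℕ}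
    (hN₁ : maximalIdeal R ^ N₁ ≤ Ideal.span {a₁} ⊔ Ideal.ofList B₁)
    (hN₂ : maximalIdeal R ^ N₂ ≤ Ideal.span {a₂} ⊔ Ideal.ofList B₂) :
    ∃ g ∈ maximalIdeal R, (∃ N, maximalIdeal R ^ N ≤ Ideal.span {g} ⊔ Ideal.ofList B₁) ∧
      (∃ N, maximalIdeal R ^ N ≤ Ideal.span {g} ⊔ Ideal.ofList B₂) := by
  set S := (Ideal.ofList B₁).minimalPrimes ∪ (Ideal.ofList B₂).minimalPrimes with hS
  have hSfin : S.Finite :=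
    (Ideal.finite_minimalPrimes_of_isNoetherianRing R (Ideal.ofList B₁)).union
      (Ideal.finite_minimalPrimes_of_isNoetherianRing R (Ideal.ofList B₂))
  have hSprime : ∀ 𝔮 ∈ S, 𝔮.IsPrime := fun 𝔮 h𝔮 => h𝔮.elim (fun h => h.1.1) (fun h => h.1.1)
  have hnot : ¬ ((maximalIdeal R : Set R) ⊆ ⋃ 𝔮 ∈ S, ((id 𝔮 : Ideal R) : Set R)) := by
    intro hsub
    obtain ⟨𝔮, h𝔮S, hle⟩ := (Ideal.subset_union_prime_finite hSfin (f := id) ⊥ ⊥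
      (fun 𝔮 h _ _ => hSprime 𝔮 h)).mp hsub
    have h𝔮𝔪 : 𝔮 = maximalIdeal R :=
      ((IsLocalRing.maximalIdeal.isMaximal R).eq_of_le (hSprime 𝔮 h𝔮S).ne_top hle).symm
    rcases h𝔮S with h | h
    · exact socleOne_maximalIdeal_notMem_minimalPrimes_ofList B₁ hB₁ (h𝔮𝔪 ▸ h)
    · exact socleOne_maximalIdeal_notMem_minimalPrimes_ofList B₂ hB₂ (h𝔮𝔪 ▸ h)
  obtain ⟨g, hg𝔪, hg⟩ := Set.not_subset.mp hnot
  simp only [Set.mem_iUnion, id, SetLike.mem_coe, not_exists] at hg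
  exact ⟨g, hg𝔪,
    exists_pow_le_span_sup_of_forall_notMem ha₁ hN₁ fun 𝔮 h𝔮 => hg 𝔮 (Or.inl h𝔮),
    exists_pow_le_span_sup_of_forall_notMem ha₂ hN₂ fun 𝔮 h𝔮 => hg 𝔮 (Or.inr h𝔮)⟩

-- adapted from Literature/RingTheory/RegularLocalRing/ParameterIdealSocle.lean
-- (`colon_cyclic_iff_exchange`)
/-- **One exchange preserves cyclicity of the socle**: if `(C, a, A)` is a parameter list of a
Noetherian local ring all of whose parameter lists are weakly regular, and `g ∈ 𝔪` is such that
`(C, g, A)` is again `𝔪`-primary, then `R/(C, a, A)` has cyclic socle iff `R/(C, g, A)` has.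
[cite: BrunsHerzog1998, Lemma 1.2.4 and 1.2.19] -/
theorem socleOne_colon_cyclic_iff_exchange {R : Type*} [CommRing R] [IsLocalRing R]
    (hCM : ∀ Q : List R, (Q.length : WithBot ℕ∞) = ringKrullDim R →
      (∀ q ∈ Q, q ∈ maximalIdeal R) → (∃ N : ℕ, maximalIdeal R ^ N ≤ Ideal.ofList Q) →
      IsWeaklyRegular R Q)
    (C A : List R) {a g : R}
    (hlen : ((C ++ a :: A).length : WithBot ℕ∞) = ringKrullDim R)
    (hm : ∀ q ∈ C ++ a :: A, q ∈ maximalIdeal R) {N : ℕ}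
    (hN : maximalIdeal R ^ N ≤ Ideal.ofList (C ++ a :: A)) (hg : g ∈ maximalIdeal R) {N' : ℕ}
    (hN' : maximalIdeal R ^ N' ≤ Ideal.ofList (C ++ g :: A)) :
    (∃ s, (Ideal.ofList (C ++ a :: A)).colon (maximalIdeal R : Set R) =
        Ideal.ofList (C ++ a :: A) ⊔ Ideal.span {s}) ↔
      (∃ s, (Ideal.ofList (C ++ g :: A)).colon (maximalIdeal R : Set R) =
        Ideal.ofList (C ++ g :: A) ⊔ Ideal.span {s}) := by
  have ha : a ∈ maximalIdeal R := hm a (by simp)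
  have hmB : ∀ q ∈ C ++ A, q ∈ maximalIdeal R := fun q hq => hm q (by
    simp only [List.mem_append, List.mem_cons] at hq ⊢; tauto)
  have hlenB : ∀ b : R, (((C ++ A) ++ [b]).length : WithBot ℕ∞) = ringKrullDim R := fun b => by
    rw [← hlen]; simp only [List.length_append, List.length_cons, List.length_nil]; ring_nf
  have hreg : ∀ b : R, b ∈ maximalIdeal R → ∀ M : ℕ,
      maximalIdeal R ^ M ≤ Ideal.ofList (C ++ b :: A) →
      ∀ x, b * x ∈ Ideal.ofList (C ++ A) → x ∈ Ideal.ofList (C ++ A) := by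
    intro b hb M hM
    refine socleOne_mem_of_mul_mem hCM (C ++ A) b (hlenB b) (fun q hq => ?_) (N := M) ?_
    · simp only [List.mem_append, List.mem_cons, List.not_mem_nil, or_false] at hq
      rcases hq with (hq | hq) | rfl
      · exact hmB q (List.mem_append_left _ hq)
      · exact hmB q (List.mem_append_right _ hq)
      · exact hb
    · rwa [ofList_concat, ← ofList_append_cons]
  rw [ofList_append_cons C A a, ofList_append_cons C A g]
  exact ⟨fun ⟨s, hs⟩ => exists_colon_eq_sup_span_swap ha hg (hreg a ha N hN) (hreg g hg N' hN') hs,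
    fun ⟨s, hs⟩ => exists_colon_eq_sup_span_swap hg ha (hreg g hg N' hN') (hreg a ha N hN) hs⟩

-- adapted from Literature/RingTheory/RegularLocalRing/ParameterIdealSocle.lean
-- (`colon_cyclic_iff_of_append`)
/-- **The chain**: in a Noetherian local ring all of whose parameter lists are weakly regular, two
parameter lists with a common initial segment `C` give quotients whose socles are simultaneously
cyclic or not (induction on the length of the differing tails, exchanging their first members for
a common `g`). [cite: BrunsHerzog1998, Lemma 1.2.19] -/
theorem socleOne_colon_cyclic_iff_of_append {R : Type*} [CommRing R] [IsNoetherianRing R]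
    [IsLocalRing R]
    (hCM : ∀ Q : List R, (Q.length : WithBot ℕ∞) = ringKrullDim R →
      (∀ q ∈ Q, q ∈ maximalIdeal R) → (∃ N : ℕ, maximalIdeal R ^ N ≤ Ideal.ofList Q) →
      IsWeaklyRegular R Q)
    (m : ℕ) : ∀ (C A₁ A₂ : List R), A₁.length = m →
    A₂.length = m → ((C ++ A₁).length : WithBot ℕ∞) = ringKrullDim R →
    (∀ q ∈ C ++ A₁, q ∈ maximalIdeal R) → (∀ q ∈ C ++ A₂, q ∈ maximalIdeal R) →
    (∀ N₁ N₂ : ℕ, maximalIdeal R ^ N₁ ≤ Ideal.ofList (C ++ A₁) →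
      maximalIdeal R ^ N₂ ≤ Ideal.ofList (C ++ A₂) →
    ((∃ s, (Ideal.ofList (C ++ A₁)).colon (maximalIdeal R : Set R) =
        Ideal.ofList (C ++ A₁) ⊔ Ideal.span {s}) ↔
      (∃ s, (Ideal.ofList (C ++ A₂)).colon (maximalIdeal R : Set R) =
        Ideal.ofList (C ++ A₂) ⊔ Ideal.span {s}))) := by
  induction m with
  | zero =>
    intro C A₁ A₂ h₁ h₂ _ _ _ _ _ _ _
    rw [List.length_eq_zero_iff.mp h₁, List.length_eq_zero_iff.mp h₂]
  | succ m ih =>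
    intro C A₁ A₂ h₁ h₂ hlen hm₁ hm₂ N₁ N₂ hN₁ hN₂
    obtain ⟨a₁, A₁', rfl⟩ := List.exists_cons_of_length_eq_add_one h₁
    obtain ⟨a₂, A₂', rfl⟩ := List.exists_cons_of_length_eq_add_one h₂
    simp only [List.length_cons, Nat.add_right_cancel_iff] at h₁ h₂
    have ha₁ : a₁ ∈ maximalIdeal R := hm₁ a₁ (by simp)
    have ha₂ : a₂ ∈ maximalIdeal R := hm₂ a₂ (by simp)
    have hlen₂ : ((C ++ a₂ :: A₂').length : WithBot ℕ∞) = ringKrullDim R := by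
      rw [← hlen]; simp [h₁, h₂]
    have hlt : ∀ A' : List R, A'.length = m →
        ((C ++ A').length : WithBot ℕ∞) < ringKrullDim R := fun A' hA' => by
      rw [← hlen]
      have : (C ++ A').length < (C ++ a₁ :: A₁').length := by simp [hA', h₁]
      exact_mod_cast this
    rw [ofList_append_cons] at hN₁ hN₂
    obtain ⟨g, hg, ⟨M₁, hM₁⟩, ⟨M₂, hM₂⟩⟩ :=
      socleOne_exists_exchange (C ++ A₁') (C ++ A₂') (hlt A₁' h₁) (hlt A₂' h₂) ha₁ ha₂ hN₁ hN₂
    rw [← ofList_append_cons] at hN₁ hN₂ hM₁ hM₂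
    have hmg : ∀ {A' : List R} {a : R}, (∀ q ∈ C ++ a :: A', q ∈ maximalIdeal R) →
        ∀ q ∈ C ++ g :: A', q ∈ maximalIdeal R := fun hm q hq => by
      simp only [List.mem_append, List.mem_cons] at hq
      rcases hq with hq | rfl | hq
      · exact hm q (List.mem_append_left _ hq)
      · exact hg
      · exact hm q (by simp [hq])
    rw [socleOne_colon_cyclic_iff_exchange hCM C A₁' hlen hm₁ hN₁ hg hM₁,
      socleOne_colon_cyclic_iff_exchange hCM C A₂' hlen₂ hm₂ hN₂ hg hM₂]
    have key := ih (C ++ [g]) A₁' A₂' h₁ h₂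
    simp only [List.append_assoc, List.singleton_append] at key
    exact key (by rw [← hlen]; simp) (hmg hm₁) (hmg hm₂) M₁ M₂ hM₁ hM₂

/-- **The type of a Cohen–Macaulay local ring is an invariant** (cyclic-socle form). Let `(R, 𝔪)` be
a Noetherian local ring such that every list of `dim R` elements of `𝔪` generating an `𝔪`-primary
ideal is a weakly regular sequence (e.g. `R` Cohen–Macaulay). If ONE such parameter ideal `(Q₁)` has
cyclic socle `((Q₁) : 𝔪) = (Q₁) + (t₁)`, then EVERY parameter ideal `(Q₂)` has: the exchange chain
of Matsumura 18.1 with the regularity of the exchanged member modulo the retained ones read off the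
hypothesis `hCM`. [cite: BrunsHerzog1998, Lemma 1.2.19; Matsumura1987, Thm. 18.1] -/
theorem stub_socle_cyclic_of_one (R : Type) [CommRing R] [IsNoetherianRing R] [IsLocalRing R]
    (hCM : ∀ Q : List R, (Q.length : WithBot ℕ∞) = ringKrullDim R →
      (∀ q ∈ Q, q ∈ IsLocalRing.maximalIdeal R) →
      (∃ N : ℕ, IsLocalRing.maximalIdeal R ^ N ≤ Ideal.ofList Q) →
      RingTheory.Sequence.IsWeaklyRegular R Q)
    (Q₁ Q₂ : List R) (h₁ : (Q₁.length : WithBot ℕ∞) = ringKrullDim R)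
    (h₂ : (Q₂.length : WithBot ℕ∞) = ringKrullDim R)
    (hm₁ : ∀ q ∈ Q₁, q ∈ IsLocalRing.maximalIdeal R) (hm₂ : ∀ q ∈ Q₂, q ∈ IsLocalRing.maximalIdeal R)
    (N₁ N₂ : ℕ) (hN₁ : IsLocalRing.maximalIdeal R ^ N₁ ≤ Ideal.ofList Q₁)
    (hN₂ : IsLocalRing.maximalIdeal R ^ N₂ ≤ Ideal.ofList Q₂) (t₁ : R)
    (hsoc : (Ideal.ofList Q₁).colon (IsLocalRing.maximalIdeal R : Set R) =
      Ideal.ofList Q₁ ⊔ Ideal.span {t₁}) :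
    ∃ t₂ : R, (Ideal.ofList Q₂).colon (IsLocalRing.maximalIdeal R : Set R) =
      Ideal.ofList Q₂ ⊔ Ideal.span {t₂} := by
  have hlen : Q₂.length = Q₁.length := by
    have := h₂.trans h₁.symm
    exact_mod_cast this
  have h := socleOne_colon_cyclic_iff_of_append hCM Q₁.length [] Q₁ Q₂ rfl hlen
    (by simpa using h₁) (by simpa using hm₁) (by simpa using hm₂) N₁ N₂ (by simpa using hN₁)
    (by simpa using hN₂)
  simp only [List.nil_append] at h
  exact h.mp ⟨t₁, hsoc⟩

end Summit.ResolutionOfSingularities.ResolutionOfSingularities.Theorems.FRationalResolution
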